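import Summits.HodgeConjecture.HodgeConjecture.Theses.LimitExtension

/-!
# Crux `LimitExtensionFour` (stmt-HodgeConjecture-2996) — `Lines/birth.lean`, the BC3 birth skeleton

Route `LimitExtension` (sub-problem `HodgeConjecture`), crux #4
`Summit.HodgeConjecture.HodgeConjecture.Theses.LimitExtension.LimitExtensionFour` — limit extension at
the first open dimension: for a smooth projective fourfold `X` and a rational `(2,2)`-class
`α ∈ H⁴(X(ℂ); ℂ)` there are a flat proper family `f : W → T` over a smooth irreducible curve, a point
`t₀`, a morphism `g : X → W_{t₀}` which is an open immersion on a nonempty open subset, and a RATIONAL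
class `B ∈ H⁴(W(ℂ); ℂ)` such that every fibre `W_t`, `t ≠ t₀`, is a smooth hypersurface fourfold on
which `B` is of type `(2,2)`, and `α − (g ≫ ι_{t₀})^* B ∈ N¹H⁴(X) = supportedClasses X 4 1`.

Registrar one-shot (route re-audit bin REPAIRABLE; no `Disproof.lean`, no earlier line, no crux idea
exists for this crux — `ledger crux ls stmt-HodgeConjecture-2996`: no workfiles). The skeleton cuts the
crux along the CONIVEAU DICHOTOMY by which the route uses it (`PullbackGlue`: LE ∧ HC(hypersurfaces) ⟹
every middle class lies in `N¹`) and along the one Hodge-theoretic theorem its intended proof quotes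
(Deligne's théorème de la partie fixe), into three named stubs of three different kinds:

* `stub_hypersurfaceDegeneration` (ALGEBRAIC GEOMETRY, known in print; L/XL as Lean) — the `B`-free
  PRESENTATION: every smooth projective fourfold `X` is, through a morphism `g` that is an open
  immersion on a nonempty open subset, a birational model of (a component of) the special fibre of a
  flat proper family over a smooth irreducible curve all of whose other fibres are smooth hypersurface
  fourfolds.  Intended witness: a generic linear projection `X → X' ⊂ ℙ⁵` (finite, birational onto the
  hypersurface `X' = V(F)`, `deg F = deg X`; an isomorphism over the smooth locus of `X'` because `X` is
  the normalisation of `X'`), the pencil `V(F + tG) ⊂ ℙ⁵ × 𝔸¹` with `G` a general form of the same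
  degree (the line `⟨F, G⟩` is not inside the discriminant, so all but finitely many members are
  smooth; `T :=` the pencil line minus the singular members other than `t₀ = [F]`, an open subset of
  `ℙ¹`), `W → T` the incidence divisor (a relative Cartier divisor, flat; closed in `ℙ⁵ × T`, proper).
  Sources: Hartshorne I.4.9 / Shafarevich II.5.4 (every variety is birational to a hypersurface, by
  generic projection), Hartshorne II.8.18 + III.10.9 (Bertini; generic smoothness), III.9.9 (flatness
  of families of hypersurfaces of constant degree).  By itself it yields the crux for every `α ∈ N¹`
  (take `B = 0`).
* `stub_hodgeTypePropagates` (HODGE THEORY, known in print; XL as Lean) — Deligne's theorem of the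
  fixed part in the crux's own setting: for a flat proper family over a smooth irreducible curve whose
  fibres off `t₀` are smooth projective fourfolds and a RATIONAL global class `B ∈ H⁴(W(ℂ); ℂ)`, if
  `B|_{W_{t₁}}` is of type `(2,2)` at ONE point `t₁ ≠ t₀` then `B|_{W_t}` is of type `(2,2)` at EVERY
  `t ≠ t₀`.  Proof route: restrict the family to `T* = T ∖ {t₀}` (flat + smooth fibres ⟹ smooth of
  relative dimension 4, proper: an `IsSmoothProjectiveFamily`); `t ↦ B|_{W_t}` is the continuous global
  section `globalSection` of `FiberClass` (tree, `HodgeLocus.lean`) with rational values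
  (`IsRationalClass.pullback`); apply the tree's named fact
  `Literature.AlgebraicGeometry.HodgeTheory.charlesSchnell_hodgeClass_of_flat` (Charles–Schnell 2014
  Prop. 11.3.5 (1) ⟸ Deligne, Hodge II, Thm. 4.1.1 + semisimplicity) on each affine open `U ∖ {t₀}` of
  `T*` (smooth, quasi-projective, with CONNECTED complex points: an irreducible smooth affine curve
  minus a point), and chain through the cover (any two nonempty opens of the irreducible `T` meet).
  No quasi-projectivity / separatedness of `T` is assumed, exactly as in the crux.
  Sources: DeligneHodgeII1971 Thm. 4.1.1–Cor. 4.1.2; CharlesSchnell2014Notes Thm. 11.3.4, Prop. 11.3.5 (1);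
  VoisinHodgeII2003 Thm. 4.18 (topological half, PROVED in tree:
  `Literature.AlgebraicTopology.Homotopy.SerreInvariantCycles.exists_class_of_flat`).
* `stub_boundaryHodgeLimit` (THE HEART, OPEN; XL) — boundary limit extension for the classes that
  carry content, with a POINTWISE Hodge condition: for a rational `(2,2)`-class `α` NOT supported on a
  divisor (`α ∉ N¹H⁴(X)`) there are a hypersurface degeneration onto `X` as above and a rational class
  `B` on its total space whose limit on `X` is `α` modulo `N¹` and which is of type `(2,2)` on ONE
  smooth fibre `W_{t₁}`, `t₁ ≠ t₀`.  This is where the route's 'why it might fail' lives (the curve `T`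
  must sit in a Hodge-locus component of the degree-`e` hypersurface fourfolds whose closure passes
  through the boundary point `[X']` with limit `α`; BaldiKlinglerUllmo2024: for `e ≥ 6` such
  positive-dimensional components are atypical).  What the reformulation buys: the `∀ t ≠ t₀` Hodge
  condition of the crux (a condition on the whole curve, `T* ⊆` Hodge locus) is replaced by "`B`
  rational on the total space + Hodge at one point" — the form in which witnesses are produced
  (classes of relative cycles, Noether–Lefschetz-type constructions at one smooth member) and in
  which the CDK / IVHS analysis at the boundary is phrased (GriffithsHarris1985, CilibertoLopez1991
  for `k = 1`; Otwinowska2002; CattaniDeligneKaplan1995JAMS).  HC-implied (under HC no rational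
  `(2,2)`-class lies outside `N² ⊆ N¹`, so the hypothesis is never met) — irrefutable short of `¬HC`,
  like the crux; by contraposition it is the route's "local obstruction to algebraicity of a given
  class".  First honest test (crux docstring): `X = S × S'` with a rational Hodge isometry of
  transcendental lattices, `α` its graph class.

`LimitExtensionFour_of` (real proof, no `sorry` of its own) concludes the crux BY NAME: case
`α ∈ N¹` — presentation stub with `B := 0` (`IsRationalClass.zero`; `IsOfHodgeType.zero` on each
smooth hypersurface fibre through the route's PROVED support `HodgeModels_holds`; `map_zero`,
`sub_zero`); case `α ∉ N¹` — the heart gives the family, `B` and one Hodge fibre, and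
`stub_hodgeTypePropagates` spreads the Hodge type to every fibre off `t₀`.

## Disproof used / negatives / dedup
No `Cruxes/LimitExtensionFour/Disproof.lean` exists (no `_false_without_` obstruction to honour, no
landed `Negative/` lemma).  `ledger negatives --problem HodgeConjecture` (2 refuted statements:
`DerivedTorelliFermatK3Exhaustion`, Fermat character multisets; `ELineTransportELineConnectivity`,
22 × 22 rational matrices) — no stub is an instance of either.  Item evidence respected: the refuter
route reviews (LimitExtensionFour = `LimitExtensionMid` at `k = 2`; HC ⇒ it with `B = 0`; Hodge type on
fibres needs Hodge models of hypersurface fourfolds — supplied here by `HodgeModels_holds` and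
`IsSmoothHypersurface.1`).  No stub is the `k = 2` instance of `LimitExtensionMid` or any other route
item (costume check): stub 1 has no class `B`, stub 2 is a `∀`-statement about a given family, stub 3
has the extra hypothesis `α ∉ N¹` and the one-fibre conclusion.

## BC3 probes (planner folder `bc/probes_pass1.lean`, `bc/probes_pass2_*.lean`; raw output in NOTES.md)
For each stub statement `S` (local defs `S1 S2 S3`, verbatim) the implications `S → LimitExtensionFour`
and `S → HodgeConjecture` FAIL (maxHeartbeats 400000): pass 1, the literal battery
`first | exact? | simpa | aesop` — rc 1, 6 errors / 6 examples, each `unsolved goals ⊢ LimitExtensionFour`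
resp. `⊢ HodgeConjecture` (every alternative ran; plain `aesop` failed by exhaustion, no timeout); pass 2,
one tactic per example — `unfold S C; exact?` 6/6 "could not close the goal", `simpa [S, C]` 6/6 fail,
`unfold S C; simpa` 6/6 fail, `exact fun h => h` 6/6 type mismatch, `unfold S C; aesop` 3/6 heartbeat
timeout at `whnf` (the `→ LimitExtensionFour` goals) + 3/6 unsolved goals.  No stub is cheaply the crux
or the summit.
-/

set_option linter.dupNamespace false

namespace Summit.HodgeConjecture.HodgeConjecture.Cruxes.LimitExtensionFour.Birth

open Summit.HodgeConjecture.HodgeConjecture.Theses.LimitExtension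
open CategoryTheory
open Literature.AlgebraicGeometry.Motives Literature.AlgebraicGeometry.HodgeTheory

/-- **STUB 1 — hypersurface degeneration onto a birational model (presentation; known in print).**
Every smooth projective complex fourfold `X` admits a flat proper family `f : W → T` over a smooth
irreducible curve, a point `t₀ ∈ T(ℂ)` and a morphism `g : X → W_{t₀}` restricting to an open immersion
on a nonempty open `U ⊆ X`, such that every other fibre `W_t` is a smooth hypersurface fourfold (of some
degree).  Witness: generic projection `X → X' ⊂ ℙ⁵` and the pencil `X' + tG`, `G` general of degree
`deg X'`, over `ℙ¹` minus the other singular members. [Hartshorne1977 I.4.9, II.8.18, III.9.9, III.10.9]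
[Shafarevich1994 II.5.4] -/
theorem stub_hypersurfaceDegeneration :
    ∀ ⦃X : SchemeOver ℂ⦄, IsSmoothProjective 4 X →
      ∃ (T W : SchemeOver ℂ) (f : W ⟶ T) (t₀ : ComplexPoints T) (g : X ⟶ fiberOver f t₀),
        AlgebraicGeometry.SmoothOfRelativeDimension 1 T.hom ∧ IrreducibleSpace T.left ∧
        AlgebraicGeometry.Flat f.left ∧ AlgebraicGeometry.IsProper f.left ∧
        (∃ U : X.left.Opens, (U : Set X.left).Nonempty ∧
          AlgebraicGeometry.IsOpenImmersion (U.ι ≫ g.left)) ∧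
        ∀ t : ComplexPoints T, t ≠ t₀ → ∃ d : ℕ, IsSmoothHypersurface 4 d (fiberOver f t) := by
  sorry

/-- **STUB 2 — Hodge type propagates along the smooth fibres (Deligne's theorem of the fixed part, in
the crux's setting; known in print).**  `f : W → T` flat proper over a smooth irreducible curve, fibres
off `t₀` smooth projective fourfolds, `B ∈ H⁴(W(ℂ); ℂ)` rational: if `B|_{W_{t₁}}` is of type `(2,2)`
for one `t₁ ≠ t₀`, then `B|_{W_t}` is of type `(2,2)` for every `t ≠ t₀`.  Nearest typed form: the
tree's named fact `charlesSchnell_hodgeClass_of_flat` applied to the restricted family over the affine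
opens of `T ∖ {t₀}` (connected complex points) and the continuous rational section `t ↦ B|_{W_t}`.
[DeligneHodgeII1971 Thm. 4.1.1, Cor. 4.1.2] [CharlesSchnell2014Notes Prop. 11.3.5 (1)]
[VoisinHodgeII2003 Thm. 4.18] -/
theorem stub_hodgeTypePropagates :
    ∀ ⦃T W : SchemeOver ℂ⦄ (f : W ⟶ T) (t₀ : ComplexPoints T) (B : complexBetti W 4),
      AlgebraicGeometry.SmoothOfRelativeDimension 1 T.hom → IrreducibleSpace T.left →
      AlgebraicGeometry.Flat f.left → AlgebraicGeometry.IsProper f.left →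
      (∀ t : ComplexPoints T, t ≠ t₀ → IsSmoothProjective 4 (fiberOver f t)) →
      IsRationalClass B →
      ∀ t₁ : ComplexPoints T, t₁ ≠ t₀ →
        IsOfHodgeType 4 (fiberOver f t₁) 4 2 2 (complexBetti.map (fiberι f t₁) 4 B) →
        ∀ t : ComplexPoints T, t ≠ t₀ →
          IsOfHodgeType 4 (fiberOver f t) 4 2 2 (complexBetti.map (fiberι f t) 4 B) := by
  sorry

/-- **STUB 3 — boundary Hodge limit for classes not supported on a divisor (the heart; OPEN).**  For a
smooth projective fourfold `X` and a rational `(2,2)`-class `α ∉ N¹H⁴(X)` there are a hypersurface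
degeneration `(T, W, f, t₀, g)` onto `X` as in STUB 1 and a RATIONAL class `B ∈ H⁴(W(ℂ); ℂ)` with
`α − (g ≫ ι_{t₀})^*B ∈ N¹H⁴(X)` which is of type `(2,2)` on ONE smooth fibre `W_{t₁}`, `t₁ ≠ t₀` —
i.e. the Hodge locus of the degree-`e` hypersurface fourfolds accumulates at the boundary point `[X']`
with limit `α` modulo coniveau 1.  HC-implied (vacuous under HC); the crux's 'why it might fail'
(BKU atypicality for `e ≥ 6`) is the why-it-might-fail of this stub. [GriffithsHarris1985]
[CilibertoLopez1991] [Otwinowska2002] [CattaniDeligneKaplan1995JAMS] [BaldiKlinglerUllmo2024] -/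
theorem stub_boundaryHodgeLimit :
    ∀ ⦃X : SchemeOver ℂ⦄, IsSmoothProjective 4 X → ∀ α : complexBetti X 4, IsRationalClass α →
      IsOfHodgeType 4 X 4 2 2 α → α ∉ supportedClasses X 4 1 →
      ∃ (T W : SchemeOver ℂ) (f : W ⟶ T) (t₀ : ComplexPoints T) (g : X ⟶ fiberOver f t₀)
        (B : complexBetti W 4),
        AlgebraicGeometry.SmoothOfRelativeDimension 1 T.hom ∧ IrreducibleSpace T.left ∧
        AlgebraicGeometry.Flat f.left ∧ AlgebraicGeometry.IsProper f.left ∧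
        (∃ U : X.left.Opens, (U : Set X.left).Nonempty ∧
          AlgebraicGeometry.IsOpenImmersion (U.ι ≫ g.left)) ∧
        IsRationalClass B ∧
        (∀ t : ComplexPoints T, t ≠ t₀ → ∃ d : ℕ, IsSmoothHypersurface 4 d (fiberOver f t)) ∧
        (∃ t₁ : ComplexPoints T, t₁ ≠ t₀ ∧
          IsOfHodgeType 4 (fiberOver f t₁) 4 2 2 (complexBetti.map (fiberι f t₁) 4 B)) ∧
        α - complexBetti.map (g ≫ fiberι f t₀) 4 B ∈ supportedClasses X 4 1 := by
  sorry

/-- **COMPOSITION (real proof, no `sorry` of its own): the three stubs imply the crux BY NAME.**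
Coniveau dichotomy on `α`: if `α ∈ N¹H⁴(X)` the presentation of STUB 1 with `B := 0` is a witness
(`0` is rational, and of type `(2,2)` on every smooth hypersurface fibre, which has a Hodge model by the
route's proved support `HodgeModels_holds`); otherwise STUB 3 supplies the family, the rational class
`B`, the limit condition and ONE Hodge fibre, and STUB 2 propagates the Hodge type to all fibres off
`t₀`.  `closed = false` only through the three `stub_*`. -/
theorem LimitExtensionFour_of : LimitExtensionFour := by
  intro X hX α hαr hαh
  by_cases hN : α ∈ supportedClasses X 4 1
  · -- coniveau-1 classes: any hypersurface degeneration, `B = 0`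
    obtain ⟨T, W, f, t₀, g, hT, hirr, hfl, hpr, hU, hhyp⟩ := stub_hypersurfaceDegeneration hX
    refine ⟨T, W, f, t₀, g, 0, hT, hirr, hfl, hpr, hU, IsRationalClass.zero, fun t ht => ?_, ?_⟩
    · obtain ⟨d, hd⟩ := hhyp t ht
      obtain ⟨A⟩ := HodgeModels_holds hd.1
      refine ⟨⟨d, hd⟩, ?_⟩
      rw [map_zero]
      exact IsOfHodgeType.zero A 4 2 2
    · rw [map_zero, sub_zero]
      exact hN
  · -- classes not supported on a divisor: boundary Hodge limit + propagation of the Hodge type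
    obtain ⟨T, W, f, t₀, g, B, hT, hirr, hfl, hpr, hU, hBr, hhyp, ⟨t₁, ht₁, hB₁⟩, hlim⟩ :=
      stub_boundaryHodgeLimit hX α hαr hαh hN
    refine ⟨T, W, f, t₀, g, B, hT, hirr, hfl, hpr, hU, hBr, fun t ht => ⟨hhyp t ht, ?_⟩, hlim⟩
    have hsm : ∀ s : ComplexPoints T, s ≠ t₀ → IsSmoothProjective 4 (fiberOver f s) := by
      intro s hs
      obtain ⟨d, hd⟩ := hhyp s hs
      exact hd.1
    exact stub_hodgeTypePropagates f t₀ B hT hirr hfl hpr hsm hBr t₁ ht₁ hB₁ t ht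

end Summit.HodgeConjecture.HodgeConjecture.Cruxes.LimitExtensionFour.Birth
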